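import Literature.AlgebraicGeometry.HodgeTheory.LimitMixedHodgeStructure
import Literature.AlgebraicGeometry.HodgeTheory.MonodromyWeightFiltrationSumDual
import Literature.AlgebraicGeometry.Motives.MixedHodgeStructureDual
import HarnessLib

/-!
# The dual of a limit mixed Hodge structure

For the tree's abstract `LimitMixedHodgeStructure V k` (`LimitMixedHodgeStructure.lean`: a mixed
`ℚ`-Hodge structure `(W, F)` on `V`, a nilpotent `N` with `N_ℂ F^p ⊆ F^{p-1}` and `W = W(N)[-k]`) on a
finite-dimensional `V`, the **dual** is the limit mixed Hodge structure of weight `-k` on `V^∨`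
consisting of

* the dual mixed Hodge structure `H^∨` (`Motives/MixedHodgeStructureDual.lean`: `W_r(V^∨) = (W_{-r-1})^⊥`,
  `F^p(V^∨) = (F^{1-p})^⊥`; Fujiki 1980 (1.6.2) a), Deligne *Hodge II* 1.1.6–1.1.7), and
* the nilpotent endomorphism `N^∨ := -ᵗN` — Deligne, *La conjecture de Weil II*, Prop. (1.6.9):
  "Définissons … le dual de `(V', N')` comme étant `(V'^*, -ᵗN')`. … (ii) La filtration `M` d'un
  dual est le dual de la filtration `M` de l'espace de départ (`M_i(V^*) = M_{-1-i}(V)^⊥`)",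
  formalised in the tree as `IsMonodromyWeightFiltration.dualAnnihilator_neg`
  (`MonodromyWeightFiltrationSumDual.lean`);

so that the weight filtration of `H^∨` is `W(-ᵗN)[k]`, and `-ᵗN` lowers `F^•(V^∨)` by one because
`N` lowers `F^•` by one (`⟨ᵗN_ℂ ξ, x⟩ = ⟨ξ, N_ℂ x⟩`, the tree's `dualBaseChange_dualMap_baseChange`).
The sign makes the monodromy of the dual the contragredient `ᵗT⁻¹` of `T = exp N`
(`dual_monodromy_comp`), as for the dual local system.

## Main results (definitions with bodies and theorems; no named facts)

* **`LimitMixedHodgeStructure.dual L : LimitMixedHodgeStructure (Module.Dual ℚ V) (-k)`**, with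
  `dual_toMixedHodgeStructure`, `dual_N`, `dual_N_apply`, `dual_W`, `dual_F`.
* `exp_dualMap` (`exp(ᵗg) = ᵗ(exp g)`), **`dual_monodromy`** (`T^∨ = ᵗ(exp(-N)) = ᵗ(T⁻¹)`), `dual_monodromy_comp`
  (`T^∨ ∘ ᵗT = id`).
* `LimitMixedHodgeStructure.Hom.transpose` — the transpose of a morphism of limit MHS is one
  (`f^∨ ∘ (-ᵗN₂) = (-ᵗN₁) ∘ f^∨`).
* `HodgeStructure.toLimitMixedHodgeStructure_dual` — for a pure `H` of weight `k` (`N = 0`), the dual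
  limit MHS is the limit MHS of the dual Hodge structure `H^∨`.

## References

* [Deligne1980] P. Deligne, La conjecture de Weil. II, Publ. Math. IHÉS 52 (1980), Prop. (1.6.9) (ii).
* [Fujiki1980] A. Fujiki, Duality of mixed Hodge structures of algebraic varieties, Publ. RIMS 16
  (1980), (1.6.2) a).
* [CattaniElZeinGriffithsLe2014] E. Cattani et al. (eds.), *Hodge Theory* (2014), §3.2.2.7, Def. 7.5.9.
* [DeligneHodgeII1971] P. Deligne, Théorie de Hodge II, 1.1.6–1.1.7.
-/

noncomputable section

open scoped TensorProduct

namespace Literature.AlgebraicGeometry.HodgeTheory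

universe u

variable {V : Type u} [AddCommGroup V] [Module ℚ V]

open Module
open Literature.AlgebraicGeometry.Motives (MixedHodgeStructure)
open Literature.AlgebraicGeometry.Motives.HodgeStructure (dualBaseChange)
open Literature.AlgebraicGeometry.Motives.MixedHodgeStructure (dualBaseChange_dualMap_baseChange)

namespace LimitMixedHodgeStructure

variable {k : ℤ}

/-! ### The dual limit mixed Hodge structure -/

/-- **The dual `L^∨ = (V^∨, F^•(V^∨), -ᵗN)` of a limit mixed Hodge structure `L = (V, F^•, N)` of weight
`k`** is a limit mixed Hodge structure of weight `-k` (`V` finite-dimensional): the underlying MHS is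
the dual MHS (`W_r(V^∨) = (W_{-r-1})^⊥`, `F^p(V^∨) = (F^{1-p})^⊥`, Fujiki (1.6.2) a)); its weight
filtration is the monodromy weight filtration of `-ᵗN` centred at `-k` (Deligne, Weil II, (1.6.9) (ii):
"`M_i(V^*) = M_{-1-i}(V)^⊥`" for the dual `(V^*, -ᵗN)`); and `-ᵗN` maps `F^p(V^∨) = (F^{1-p})^⊥` into
`F^{p-1}(V^∨) = (F^{2-p})^⊥` since `N` maps `F^{2-p}` into `F^{1-p}`.
[cite: Deligne1980, Prop. (1.6.9) (ii)] [cite: Fujiki1980, (1.6.2) a)] -/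
def dual [FiniteDimensional ℚ V] (L : LimitMixedHodgeStructure V k) :
    LimitMixedHodgeStructure (Module.Dual ℚ V) (-k) where
  toMixedHodgeStructure := L.toMixedHodgeStructure.dual
  N := -L.N.dualMap
  isNilpotent_N := (isNilpotent_dualMap L.isNilpotent_N).neg
  map_N_F_le p := by
    rintro _ ⟨ξ, hξ, rfl⟩
    rw [SetLike.mem_coe, MixedHodgeStructure.dual_F, Submodule.mem_comap,
      Submodule.mem_dualAnnihilator] at hξ
    rw [MixedHodgeStructure.dual_F, Submodule.mem_comap, Submodule.mem_dualAnnihilator]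
    intro x hx
    rw [LinearMap.baseChange_neg, LinearMap.neg_apply, map_neg, LinearMap.neg_apply,
      dualBaseChange_dualMap_baseChange, hξ _ ?_, neg_zero]
    have h := L.map_N_F_le (1 - (p - 1)) ⟨x, hx, rfl⟩
    rwa [show 1 - (p - 1) - 1 = 1 - p by ring] at h
  isMonodromyWeightFiltration := by
    have hW : L.toMixedHodgeStructure.dual.W = fun i => (L.W (-1 - i)).dualAnnihilator := by
      funext i
      rw [MixedHodgeStructure.dual_W, show -i - 1 = -1 - i by ring]
    rw [hW]
    exact L.isMonodromyWeightFiltration.dualAnnihilator_neg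

/-- The underlying MHS of `L^∨` is the dual MHS. [cite: Fujiki1980, (1.6.2) a)] -/
@[simp]
theorem dual_toMixedHodgeStructure [FiniteDimensional ℚ V] (L : LimitMixedHodgeStructure V k) :
    L.dual.toMixedHodgeStructure = L.toMixedHodgeStructure.dual := rfl

/-- The monodromy logarithm of `L^∨` is `-ᵗN`. [cite: Deligne1980, Prop. (1.6.9) (ii)] -/
@[simp]
theorem dual_N [FiniteDimensional ℚ V] (L : LimitMixedHodgeStructure V k) : L.dual.N = -L.N.dualMap := rfl

/-- `N^∨ φ = -φ ∘ N`. [cite: Deligne1980, Prop. (1.6.9) (ii)] -/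
theorem dual_N_apply [FiniteDimensional ℚ V] (L : LimitMixedHodgeStructure V k) (φ : Module.Dual ℚ V)
    (v : V) : L.dual.N φ v = -φ (L.N v) := rfl

/-- The weight filtration of `L^∨`: `W_r(V^∨) = (W_{-r-1})^⊥`. [cite: Deligne1980, Prop. (1.6.9) (ii)] -/
theorem dual_W [FiniteDimensional ℚ V] (L : LimitMixedHodgeStructure V k) (r : ℤ) :
    L.dual.W r = (L.W (-r - 1)).dualAnnihilator := rfl

/-- The Hodge filtration of `L^∨`: `F^p(V^∨) = (F^{1-p})^⊥` (pulled back along `ℂ ⊗ V^∨ → (ℂ ⊗ V)^∨`).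
[cite: Fujiki1980, (1.6.2) a)] -/
theorem dual_F [FiniteDimensional ℚ V] (L : LimitMixedHodgeStructure V k) (p : ℤ) :
    L.dual.F p = ((L.F (1 - p)).dualAnnihilator).comap (dualBaseChange V) := rfl

/-! ### The monodromy of the dual is the contragredient -/

/-- Transposition of powers: `ᵗ(f^n) = (ᵗf)^n`. [folklore] -/
private theorem dualMap_pow' (f : V →ₗ[ℚ] V) (n : ℕ) : (f ^ n).dualMap = f.dualMap ^ n := by
  induction n with
  | zero =>
    rw [pow_zero, pow_zero, Module.End.one_eq_id, Module.End.one_eq_id, LinearMap.dualMap_id]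
  | succ n ih =>
    rw [pow_succ, pow_succ', Module.End.mul_eq_comp, ← LinearMap.dualMap_comp_dualMap, ih,
      Module.End.mul_eq_comp]

/-- `ᵗ0 = 0`. [folklore] -/
private theorem dualMap_zero' {V' : Type*} [AddCommGroup V'] [Module ℚ V'] :
    (0 : V →ₗ[ℚ] V').dualMap = 0 :=
  map_zero (Module.Dual.transpose (R := ℚ))

/-- `ᵗ(-f) = -ᵗf`. [folklore] -/
private theorem dualMap_neg' {V' : Type*} [AddCommGroup V'] [Module ℚ V'] (f : V →ₗ[ℚ] V') :
    (-f).dualMap = -f.dualMap :=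
  map_neg (Module.Dual.transpose (R := ℚ)) f

/-- **`exp(ᵗg) = ᵗ(exp g)`** for a nilpotent `g` (`exp` is a polynomial in `g`, and transposition is
linear with `ᵗ(g^n) = (ᵗg)^n`). [cite: Deligne1980, Prop. (1.6.9) (ii)] -/
theorem exp_dualMap {g : V →ₗ[ℚ] V} (hg : IsNilpotent g) :
    IsNilpotent.exp g.dualMap = (IsNilpotent.exp g).dualMap := by
  obtain ⟨n, hn⟩ := hg
  have hn' : g.dualMap ^ n = 0 := by rw [← dualMap_pow', hn, dualMap_zero']
  rw [IsNilpotent.exp_eq_sum hn, IsNilpotent.exp_eq_sum hn']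
  change _ = Module.Dual.transpose (R := ℚ) (∑ i ∈ Finset.range n, ((i.factorial : ℚ)⁻¹ • g ^ i))
  rw [map_sum]
  refine Finset.sum_congr rfl fun i _ => ?_
  rw [map_smul]
  change _ = _ • (g ^ i).dualMap
  rw [dualMap_pow']

/-- **The monodromy of the dual is the contragredient: `T(L^∨) = exp(-ᵗN) = ᵗ(exp(-N)) = ᵗ(T⁻¹)`**
(Deligne's sign `N^∨ = -ᵗN` is the logarithm of the dual representation).
[cite: Deligne1980, Prop. (1.6.9) (ii)] -/
theorem dual_monodromy [FiniteDimensional ℚ V] (L : LimitMixedHodgeStructure V k) :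
    L.dual.monodromy = (IsNilpotent.exp (-L.N)).dualMap := by
  rw [monodromy, dual_N, ← dualMap_neg', exp_dualMap L.isNilpotent_N.neg]

/-- `T(L^∨) ∘ ᵗT(L) = id`: the monodromy of the dual is the inverse transpose of the monodromy.
[cite: Deligne1980, Prop. (1.6.9) (ii)] -/
theorem dual_monodromy_comp [FiniteDimensional ℚ V] (L : LimitMixedHodgeStructure V k) :
    L.dual.monodromy ∘ₗ L.monodromy.dualMap = LinearMap.id := by
  rw [dual_monodromy, monodromy, LinearMap.dualMap_comp_dualMap, ← Module.End.mul_eq_comp,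
    IsNilpotent.exp_mul_exp_neg_self L.isNilpotent_N, Module.End.one_eq_id, LinearMap.dualMap_id]

/-! ### Transposes of morphisms -/

namespace Hom

variable {V' : Type u} [AddCommGroup V'] [Module ℚ V']
variable {L₁ : LimitMixedHodgeStructure V k} {L₂ : LimitMixedHodgeStructure V' k}

/-- **The transpose `f^∨ : L₂^∨ → L₁^∨` of a morphism of limit mixed Hodge structures is a morphism of
limit mixed Hodge structures**: it is a morphism of the dual MHS (`MixedHodgeStructure.Hom.transpose`)
and `ᵗf ∘ ᵗN₂ = ᵗ(N₂ ∘ f) = ᵗ(f ∘ N₁) = ᵗN₁ ∘ ᵗf`. [cite: Deligne1980, Prop. (1.6.9) (ii)] -/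
def transpose [FiniteDimensional ℚ V] [FiniteDimensional ℚ V'] (f : Hom L₁ L₂) : Hom L₂.dual L₁.dual where
  toHom := f.toHom.transpose
  comm_N := by
    have h := congrArg LinearMap.dualMap f.comm_N
    rw [← LinearMap.dualMap_comp_dualMap, ← LinearMap.dualMap_comp_dualMap] at h
    rw [dual_N, dual_N, LinearMap.comp_neg, LinearMap.neg_comp, MixedHodgeStructure.Hom.transpose_toLinearMap]
    exact congrArg Neg.neg h.symm

/-- The underlying map of `f.transpose` is `ᵗf`. [cite: Deligne1980, Prop. (1.6.9) (ii)] -/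
@[simp]
theorem transpose_toLinearMap [FiniteDimensional ℚ V] [FiniteDimensional ℚ V'] (f : Hom L₁ L₂) :
    f.transpose.toLinearMap = f.toLinearMap.dualMap := rfl

end Hom

/-! ### The pure case -/

/-- A limit MHS is determined by its underlying MHS and its `N`. [folklore] -/
private theorem ext_of_toMixedHodgeStructure_of_N' {k' : ℤ} {W' : Type u} [AddCommGroup W'] [Module ℚ W']
    {L₁ L₂ : LimitMixedHodgeStructure W' k'}
    (h₁ : L₁.toMixedHodgeStructure = L₂.toMixedHodgeStructure) (h₂ : L₁.N = L₂.N) : L₁ = L₂ := by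
  obtain ⟨M₁, N₁, _, _, _⟩ := L₁
  obtain ⟨M₂, N₂, _, _, _⟩ := L₂
  simp only at h₁ h₂
  subst h₁ h₂
  rfl

/-- **For a pure Hodge structure `H` of weight `k` regarded as a limit MHS (`N = 0`), the dual limit MHS
is the dual Hodge structure `H^∨` regarded as a limit MHS** (weight `-k`, `N = -ᵗ0 = 0`; the MHS agree
by `HodgeStructure.toMixedHodgeStructure_dual`). [cite: CattaniElZeinGriffithsLe2014, §3.2.2.7 and Ex. 3.2.23 (1)] -/
theorem _root_.Literature.AlgebraicGeometry.Motives.HodgeStructure.toLimitMixedHodgeStructure_dual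
    [Motives.HodgeTensorFacts.{u, u}] [FiniteDimensional ℚ V] (H : Motives.HodgeStructure V k) :
    H.dual.toLimitMixedHodgeStructure = H.toLimitMixedHodgeStructure.dual :=
  ext_of_toMixedHodgeStructure_of_N' (H.toMixedHodgeStructure_dual)
    (by rw [dual_N, Motives.HodgeStructure.toLimitMixedHodgeStructure_N,
      Motives.HodgeStructure.toLimitMixedHodgeStructure_N, dualMap_zero', neg_zero])

end LimitMixedHodgeStructure

end Literature.AlgebraicGeometry.HodgeTheory

end
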